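import Summits.CriticalPhenomena.PercolationContinuityZ3.Theorems.PercNearOneGluingNoHeavyQuantLowCapacity
import Summits.CriticalPhenomena.PercolationContinuityZ3.Theorems.PercNearOneGluingNoHeavyQuantLawDecFlowsDecomposition
import HarnessLib

/-!
# QUANT lane R8, T-DEC: DEC of a SINGLE-LOW law is EXACTLY the capacity inequality of its low (converse of lead g22's
# `low_capacity_of_decAtT`)

builds on p205010 (kernel theorem, internal audit signed; external expert review pending)

Support file (`--supports stmt-CriticalPhenomena-4575`), QUANT lane typer seat prim-quant-stmt (gen 23), rung R8 of
`run/shared/lean/prim/quant/LADDER.md`.  Theorems only; standard axioms, no sorries.  Lead g22's `…QuantLowCapacity` (p305864) extracts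
from a DEC datum the capacity inequality `(x/(1−x))·ν l ≤ Σ_h capCoef(h)·ν h` of a low atom `l` (`capCoef = 1` on giants, `(x/(1−x))/usage`
on compatible mids, `0` elsewhere).  For a law whose ONLY low atom at `(T, j′)` is `l` the converse holds — the flow form has one row, and the
proportional flow `f l h = ν l · capCoef(h)·ν h / Σ capCoef·ν` is a witness — so for single-low laws DEC(j′) is a CLOSED-FORM inequality at
every layer (the hypotheses (H_j′), (H_λ*) of the single-low slice theorems `…QuantSliceSingleLow(CaseTwo/DEC)` are then not just
consequences but restatements of `DECAtT` at the two layers).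
* **`flowAtT_of_singleLow_capacity`** — `ν ≥ 0` vanishing above `M`, `0 < x < 1`, `l ≤ j′`, `2l < T`, every other low `k ≤ j′` has
  `ν k = 0`, and `(x/(1−x))·ν l ≤ Σ_{h ≤ M} capCoef x T j′ l h · ν h` ⟹ `FlowAtT x T j′ M ν`.
* **`decAtT_singleLow_iff`** — for probability laws: `DECAtT x T j′ M ν ↔ (x/(1−x))·ν l ≤ Σ_{h ≤ M} capCoef x T j′ l h · ν h`.

[this work]; `…QuantLawDecFlows(Decomposition)` (typer g22), `…QuantFlowUncross` (this seat), `…QuantLowCapacity` (lead g22).  Nothing here is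
cited as a published result.  The gluing rows served [cite: KozmaNitzan2024, Conjecture 3 (p. 15)]; product measure [cite: Grimmett1999, §1.3 p. 10].
-/

noncomputable section

namespace Summit.CriticalPhenomena.PercolationContinuityZ3.Theorems

namespace Quant

open Finset

namespace LawDec

/-- `usage · capCoef = x/(1−x)` wherever `capCoef ≠ 0` (giant: `usage = x/(1−x)`, `capCoef = 1`; compatible mid: `capCoef = (x/(1−x))/usage`). -/
theorem usage_mul_capCoef (x T : ℝ) (j' l h : ℕ) (hx0 : 0 < x) (hx1 : x < 1) (hlow : 2 * (l : ℝ) < T) :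
    usage x T j' l h * capCoef x T j' l h = (if j' + 1 ≤ h ∨ (T ≤ 2 * (h : ℝ) ∧ T < (l : ℝ) + h) then x / (1 - x) else 0) := by
  unfold capCoef
  by_cases hg : j' + 1 ≤ h
  · rw [if_pos hg, if_pos (Or.inl hg), usage_giant_eq x T j' l h hg, mul_one]
  · rw [if_neg hg]
    by_cases hm : T ≤ 2 * (h : ℝ) ∧ T < (l : ℝ) + h
    · rw [if_pos hm, if_pos (Or.inr hm)]
      have hlh : l < h := by
        have : (l : ℝ) < h := by linarith [hm.2]
        exact_mod_cast this
      have hu := usage_pos_of_compat x T j' l h hx0 hx1 hlow hlh (Or.inr hm.2)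
      field_simp
    · rw [if_neg hm, if_neg (fun hor => hor.elim hg hm), mul_zero]

/-- **THE CAPACITY INEQUALITY IS SUFFICIENT FOR A SINGLE-LOW LAW**: the proportional flow of the unique low atom into its compatible
absorbers, weighted by `capCoef·ν`, is a witness of the flow form. [this work] -/
theorem flowAtT_of_singleLow_capacity (x T : ℝ) (j' M l : ℕ) (ν : ℕ → ℝ) (hx0 : 0 < x) (hx1 : x < 1)
    (hν : ∀ k, 0 ≤ ν k) (hνM : ∀ k, M < k → ν k = 0) (hlj : l ≤ j') (hlow : 2 * (l : ℝ) < T)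
    (hsingle : ∀ k, k ≤ j' → 2 * (k : ℝ) < T → k ≠ l → ν k = 0)
    (hcap : x / (1 - x) * ν l ≤ ∑ h ∈ Finset.range (M + 1), capCoef x T j' l h * ν h) :
    FlowAtT x T j' M ν := by
  have h1x : 0 < 1 - x := by linarith
  have hxr : 0 < x / (1 - x) := div_pos hx0 h1x
  have hνl := hν l
  have hc0 : ∀ h, 0 ≤ capCoef x T j' l h := fun h => capCoef_nonneg x T j' l h hx0 hx1 hlow
  obtain ⟨W, hW⟩ : ∃ W : ℝ, W = ∑ h ∈ Finset.range (M + 1), capCoef x T j' l h * ν h := ⟨_, rfl⟩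
  rw [← hW] at hcap
  have hW0 : 0 ≤ W := by rw [hW]; exact Finset.sum_nonneg (fun h _ => mul_nonneg (hc0 h) (hν h))
  -- the witness: the low `l` ships ν l · capCoef(h)·ν h / W to h
  refine ⟨fun p h => (if p = l then ν l else 0) * (capCoef x T j' l h * ν h) / W, ?_, ?_, ?_, ?_⟩
  · intro p h
    have : 0 ≤ (if p = l then ν l else 0) := by split_ifs <;> linarith
    exact div_nonneg (mul_nonneg this (mul_nonneg (hc0 h) (hν h))) hW0
  · intro p h hpos
    dsimp only at hpos
    have hp : p = l := by
      by_contra hn; rw [if_neg hn, zero_mul, zero_div] at hpos; exact lt_irrefl _ hpos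
    have hW' : W ≠ 0 := by
      intro hz; rw [hz, div_zero] at hpos; exact lt_irrefl _ hpos
    rw [if_pos hp] at hpos
    have hch : capCoef x T j' l h * ν h ≠ 0 := by
      intro hz; rw [hz, mul_zero, zero_div] at hpos; exact lt_irrefl _ hpos
    have hνh : ν h ≠ 0 := fun hz => hch (by rw [hz, mul_zero])
    have hcc : capCoef x T j' l h ≠ 0 := fun hz => hch (by rw [hz, zero_mul])
    have hhM : h ≤ M := by by_contra hn; exact hνh (hνM h (by omega))
    have hcomp : j' + 1 ≤ h ∨ T < (l : ℝ) + h := by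
      unfold capCoef at hcc
      by_cases hg : j' + 1 ≤ h
      · exact Or.inl hg
      · rw [if_neg hg] at hcc
        by_cases hm : T ≤ 2 * (h : ℝ) ∧ T < (l : ℝ) + h
        · exact Or.inr hm.2
        · rw [if_neg hm] at hcc; exact absurd rfl hcc
    rw [hp]
    exact ⟨hlj, hlow, hhM, hcomp⟩
  · intro p hpj hplow
    dsimp only
    by_cases hp : p = l
    · rw [hp, if_pos rfl]
      have e : ∀ h, ν l * (capCoef x T j' l h * ν h) / W = (ν l / W) * (capCoef x T j' l h * ν h) := fun h => by ring
      simp only [e]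
      rw [← Finset.mul_sum, ← hW]
      by_cases hW' : W = 0
      · -- no capacity at all: the inequality forces ν l = 0
        have : ν l = 0 := by
          have h1 : x / (1 - x) * ν l ≤ 0 := by rw [← hW']; exact hcap
          nlinarith
        rw [this, hW']; simp
      · field_simp
    · rw [if_neg hp, hsingle p hpj hplow hp]
      simp
  · intro h hhM hself
    dsimp only
    have hlr : l ∈ Finset.range (j' + 1) := Finset.mem_range.2 (by omega)
    have e : ∀ p, usage x T j' p h * ((if p = l then ν l else 0) * (capCoef x T j' l h * ν h) / W)
        = (if p = l then usage x T j' p h * ν l * (capCoef x T j' l h * ν h) / W else 0) := by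
      intro p; split_ifs <;> ring
    simp only [e]
    rw [Finset.sum_ite_eq' (Finset.range (j' + 1)) l, if_pos hlr]
    -- usage(l,h)·capCoef(h) = x/(1−x) on the support, and (x/(1−x))·ν l ≤ W
    have huc := usage_mul_capCoef x T j' l h hx0 hx1 hlow
    by_cases hW' : W = 0
    · rw [hW', div_zero]; exact hν h
    · have hWpos : 0 < W := lt_of_le_of_ne hW0 (Ne.symm hW')
      have hval : usage x T j' l h * ν l * (capCoef x T j' l h * ν h) / W
          = (usage x T j' l h * capCoef x T j' l h) * (ν l * ν h / W) := by ring
      rw [hval, huc]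
      split_ifs with hc
      · -- (x/(1−x))·ν l·ν h / W ≤ ν h
        rw [← mul_div_assoc, div_le_iff₀ hWpos]
        have := mul_le_mul_of_nonneg_right hcap (hν h)
        nlinarith
      · rw [zero_mul]; exact hν h

/-- **DEC OF A SINGLE-LOW PROBABILITY LAW IS EXACTLY THE CAPACITY INEQUALITY OF ITS LOW** (lead g22's `low_capacity_of_decAtT` and the
converse above). [this work] -/
theorem decAtT_singleLow_iff (x T : ℝ) (j' M l : ℕ) (ν : ℕ → ℝ) (hx0 : 0 < x) (hx1 : x < 1)
    (hν : ∀ k, 0 ≤ ν k) (hνM : ∀ k, M < k → ν k = 0) (hν1 : ∑ h ∈ Finset.range (M + 1), ν h = 1)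
    (hlj : l ≤ j') (hlow : 2 * (l : ℝ) < T) (hsingle : ∀ k, k ≤ j' → 2 * (k : ℝ) < T → k ≠ l → ν k = 0) :
    DECAtT x T j' M ν ↔ x / (1 - x) * ν l ≤ ∑ h ∈ Finset.range (M + 1), capCoef x T j' l h * ν h :=
  ⟨fun hdec => low_capacity_of_decAtT x T j' M l ν hx0 hx1 hν hdec hlj hlow,
    fun hcap => decAtT_of_flowAtT x T j' M ν hx0 hx1 hνM hν1
      (flowAtT_of_singleLow_capacity x T j' M l ν hx0 hx1 hν hνM hlj hlow hsingle hcap)⟩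

end LawDec

end Quant

end Summit.CriticalPhenomena.PercolationContinuityZ3.Theorems
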